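import Summits.ResolutionOfSingularities.ResolutionOfSingularities.Theorems.PurelyInseparableDim4TschirnhausIsolation
import Summits.ResolutionOfSingularities.ResolutionOfSingularities.Theorems.PurelyInseparableDim4TschirnhausCone
import HarnessLib
import HarnessLib.Audit.Tags

/-!
# Purely inseparable four-folds — THE TSCHIRNHAUS JET FRAME IS CANONICAL: two frames that straighten the
# cone onto `x_f` and are Tschirnhaus to order `N` agree, and so do all frame readings of `u`-degree `≤ N`
# (cell `res-dim4-pi`, K2(p) lane, brick K24a part β2 / FILE D4)

[OURS · counted 0 · cell `res-dim4-pi` · K2(p) lane (holder res-dim4-p-12 g3, «p-1 takes K24a» 2026-08-29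
01:14Z, statement layer 01:24Z stub β2) · seat res-dim4-p-1 g3 · over FILE D (`…TschirnhausJet`, jet existence
/ uniqueness), B1/B2/B3 (res-dim4-p-11: `tsch`, `tsch_sub_self_mem`, `homogeneousComponent_tsch`).]  Nothing
here proves K2(p)/K2(5), `NoIsolatedTrap p p` or resolution of singularities in dimension ≥ 4 /
characteristic `p`.  AI kernel work, weaker than expert review.

A FRAME of the residual `G` (order `≥ d`, power cone `a₀·L^d` with `ℓ_f ≠ 0`) at the letter `f` is an
admissible datum `φ` (`φ(0) = 0`, `x_f ∉ vars φ`) such that `tsch f φ G` has degree-`d` part `a·x_f^d`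
(STRAIGHT) and no monomial `x_f^{d-1}·u^m`, `|m| ≤ N` (TSCHIRNHAUS to order `N`).  The two-slot game (K24a)
compares, at every step, the frame transported from the parent with the child's own frame; this file shows
that nothing depends on the choice:

* §1 `coeff_tsch_eq_of_jet_eq` — if two `x_f`-free data agree in all degrees `≤ N`, the framed polynomials
  agree at every monomial `x_f^j·u^m` with `|m| ≤ N` (second-order Taylor of FILE D, part 1).
* §2 `linearForm_eq_of_pow_eq` — `a·(x_f + μ)^d = b·(x_f + μ′)^d` with `a ≠ 0`, `d` a unit, `μ, μ′` linear
  and `x_f`-free forces `μ = μ′` (coefficients of `x_f^d` and `x_f^{d-1}x_i`); hence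
  **`linearPart_eq_of_straight`**: two frames of the same `G` have the same linear part.
* §3 **`jet_eq_of_frames`** — two frames of `G`, both straight and Tschirnhaus to order `N`, agree in all
  degrees `≤ N` (§2 + FILE D `jet_unique` on the straightened polynomial); **`coeff_tsch_eq_of_frames`** —
  so all their frame readings of `u`-degree `≤ N` coincide.

[cite: Abhyankar1990, Lecture 22 p.174 and p.186] [cite: CossartPiltant2009, I.8.3.6]
bears_on: LADDER-RESOLUTION:D157-DOOR2 (res-dim4-pi · K2(p) · slice B · K24a β2).  Supports
stmt-ResolutionOfSingularities-16155 (helper).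
-/

set_option linter.dupNamespace false -- mandated namespace of this single-conjunct summit

noncomputable section

namespace Summit.ResolutionOfSingularities.ResolutionOfSingularities.Theorems.PIDim4

namespace FrameChange

open MvPolynomial Finset
open Literature.AlgebraicGeometry.Resolution
open Literature.AlgebraicGeometry.Resolution.Hauser2010
open Literature.AlgebraicGeometry.Resolution.HauserPerlega2019

variable {K : Type} [Field K] {f : Fin 4}

/-! ## 1. Data agreeing to order `N` give the same readings of `u`-degree `≤ N` -/

/-- **Readings depend only on the `N`-jet of the datum**: if `φ`, `ψ` are `x_f`-free and agree in all degrees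
`≤ N`, then `tsch f φ P` and `tsch f ψ P` have the same coefficient at every monomial `x_f^j·u^m`, `|m| ≤ N`
(`tsch f ψ = tsch f (ψ − φ) ∘ tsch f φ`, and the move by `ψ − φ ∈ (u)^{N+1}` changes nothing below
`u`-degree `N + 1`). [cite: Abhyankar1990, Lecture 22 p.186] [folklore] -/
theorem coeff_tsch_eq_of_jet_eq {φ ψ : MvPolynomial (Fin 4) K} (hφ : f ∉ φ.vars) (hψ : f ∉ ψ.vars) {N : ℕ}
    (hjet : ∀ m : Fin 4 →₀ ℕ, m.degree ≤ N → coeff m φ = coeff m ψ) (P : MvPolynomial (Fin 4) K)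
    {m : Fin 4 →₀ ℕ} (hm : m.degree ≤ N) (j : ℕ) :
    coeff (m + Finsupp.single f j) (tsch f φ P) = coeff (m + Finsupp.single f j) (tsch f ψ P) := by
  have hδ : ∀ a ∈ (ψ - φ).support, a f = 0 ∧ N + 1 ≤ a.degree := by
    intro a ha
    refine ⟨?_, ?_⟩
    · have hψa : a f = 0 ∨ coeff a ψ = 0 := by
        by_cases h : coeff a ψ = 0
        · exact Or.inr h
        · exact Or.inl ((not_mem_vars_iff f ψ).mp hψ a (mem_support_iff.mpr h))
      have hφa : a f = 0 ∨ coeff a φ = 0 := by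
        by_cases h : coeff a φ = 0
        · exact Or.inr h
        · exact Or.inl ((not_mem_vars_iff f φ).mp hφ a (mem_support_iff.mpr h))
      rcases hψa with h | h
      · exact h
      · rcases hφa with h' | h'
        · exact h'
        · exact absurd (by rw [coeff_sub, h, h', sub_zero]) (mem_support_iff.mp ha)
    · by_contra hlt
      exact (mem_support_iff.mp ha) (by rw [coeff_sub, hjet a (by omega), sub_self])
  have hcomp : tsch f ψ = (tsch f (ψ - φ)).comp (tsch f φ) := by
    rw [tsch_comp_tsch (ψ - φ) hφ, add_sub_cancel]
  obtain ⟨R, hR⟩ := exists_taylor_two (tsch f (ψ - φ)) f (ψ - φ) (tsch_X_self f _)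
    (fun _ hi => tsch_X_of_ne _ hi) (tsch f φ P)
  have hlt : m.degree < N + 1 := Nat.lt_succ_of_le hm
  rw [hcomp, AlgHom.comp_apply, hR, coeff_add, coeff_add, coeff_add_single_mul_eq_zero hδ _ hlt, pow_two,
    mul_assoc, coeff_add_single_mul_eq_zero hδ _ hlt, add_zero, add_zero]

/-! ## 2. The linear part of a frame is forced -/

/-- The `x_f^{d-1}·x_i`-coefficient of `a·(x_f + μ)^d` for a linear `x_f`-free `μ` is `a·d·μ_i`. [folklore] -/
theorem coeff_C_mul_X_add_pow {μ : MvPolynomial (Fin 4) K} (hμ : f ∉ μ.vars) (hμ1 : μ.IsHomogeneous 1)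
    (a : K) {d : ℕ} (hd : 1 ≤ d) {i : Fin 4} (hi : i ≠ f) :
    coeff (Finsupp.single i 1 + Finsupp.single f (d - 1)) (C a * (X f + μ) ^ d) =
      a * d * coeff (Finsupp.single i 1) μ := by
  have hsupp : ∀ e ∈ μ.support, e f = 0 ∧ 1 ≤ e.degree := by
    intro e he
    refine ⟨(not_mem_vars_iff f μ).mp hμ e he, ?_⟩
    have h1 := hμ1 (mem_support_iff.mp he)
    rw [ResCone.weight_one_eq_degree] at h1
    omega
  -- `(x_f + μ)^d = tsch f μ (x_f^d) = x_f^d + μ·d·x_f^{d-1} + μ²·R`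
  have htsch : (X f + μ) ^ d = tsch f μ (X f ^ d) := by rw [map_pow, tsch_X_self]
  obtain ⟨R, hR⟩ := exists_taylor_two (tsch f μ) f μ (tsch_X_self f μ) (fun _ hi => tsch_X_of_ne μ hi)
    (X f ^ d)
  have hX : coeff (Finsupp.single i 1 + Finsupp.single f (d - 1)) ((X f : MvPolynomial (Fin 4) K) ^ d) = 0 := by
    rw [X_pow_eq_monomial, coeff_monomial, if_neg]
    intro h
    have := DFunLike.congr_fun h i
    rw [Finsupp.single_apply, if_neg hi.symm, Finsupp.add_apply, Finsupp.single_eq_same,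
      Finsupp.single_apply, if_neg hi.symm] at this
    omega
  have hlin : coeff (Finsupp.single i 1 + Finsupp.single f (d - 1))
      (μ * pderiv f ((X f : MvPolynomial (Fin 4) K) ^ d)) = coeff (Finsupp.single i 1) μ * d := by
    rw [coeff_add_single_mul_of_degree_le hsupp _ (by rw [Finsupp.degree_single]) (d - 1), coeff_pderiv,
      ← Finsupp.single_add, Nat.sub_add_cancel hd, X_pow_eq_monomial, coeff_monomial, if_pos rfl,
      Finsupp.single_eq_same, cast_pred_add_one hd, one_mul]
  have hsq : coeff (Finsupp.single i 1 + Finsupp.single f (d - 1)) (μ ^ 2 * R) = 0 := by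
    rw [pow_two, mul_assoc, coeff_add_single_mul_of_degree_le hsupp _ (by rw [Finsupp.degree_single]) (d - 1),
      ← zero_add (Finsupp.single f (d - 1)),
      coeff_add_single_mul_eq_zero hsupp R (by rw [map_zero]; exact Nat.one_pos) (d - 1), mul_zero]
  rw [coeff_C_mul, htsch, hR, coeff_add, coeff_add, hX, hlin, hsq, zero_add, add_zero]
  ring

/-- **`a·(x_f + μ)^d = b·(x_f + μ′)^d` forces `μ = μ′`** for `a ≠ 0`, `d ≠ 0` in `K`, `μ, μ′` linear and
`x_f`-free (the `x_f^d`-coefficients give `a = b`, the `x_f^{d-1}x_i`-coefficients `a d μ_i = b d μ′_i`).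
[folklore] -/
theorem linearForm_eq_of_pow_eq {μ μ' : MvPolynomial (Fin 4) K} (hμ : f ∉ μ.vars) (hμ1 : μ.IsHomogeneous 1)
    (hμ' : f ∉ μ'.vars) (hμ'1 : μ'.IsHomogeneous 1) {a b : K} (ha : a ≠ 0) {d : ℕ} (hd : 1 ≤ d)
    (hdK : (d : K) ≠ 0) (h : C a * (X f + μ) ^ d = C b * (X f + μ') ^ d) : μ = μ' := by
  -- `a = b` from the `x_f^d`-coefficients
  have hsuppμ : ∀ e ∈ μ.support, e f = 0 ∧ 1 ≤ e.degree := fun e he =>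
    ⟨(not_mem_vars_iff f μ).mp hμ e he, by
      have h1 := hμ1 (mem_support_iff.mp he); rw [ResCone.weight_one_eq_degree] at h1; omega⟩
  have hsuppμ' : ∀ e ∈ μ'.support, e f = 0 ∧ 1 ≤ e.degree := fun e he =>
    ⟨(not_mem_vars_iff f μ').mp hμ' e he, by
      have h1 := hμ'1 (mem_support_iff.mp he); rw [ResCone.weight_one_eq_degree] at h1; omega⟩
  have htop : ∀ (ν : MvPolynomial (Fin 4) K), (∀ e ∈ ν.support, e f = 0 ∧ 1 ≤ e.degree) → ∀ c : K,
      coeff (Finsupp.single f d) (C c * (X f + ν) ^ d) = c := by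
    intro ν hν c
    rw [coeff_C_mul, show (X f + ν) ^ d = tsch f ν (X f ^ d) by rw [map_pow, tsch_X_self],
      coeff_single_frameChange (tsch f ν) f ν (tsch_X_self f ν) (fun _ hi => tsch_X_of_ne ν hi) hν _ d,
      X_pow_eq_monomial, coeff_monomial, if_pos rfl, mul_one]
  have hab : a = b := by
    have h1 := congrArg (coeff (Finsupp.single f d)) h
    rwa [htop μ hsuppμ, htop μ' hsuppμ'] at h1
  subst hab
  -- the linear coefficients
  have hcoef : ∀ i, i ≠ f → coeff (Finsupp.single i 1) μ = coeff (Finsupp.single i 1) μ' := by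
    intro i hi
    have h1 := congrArg (coeff (Finsupp.single i 1 + Finsupp.single f (d - 1))) h
    rw [coeff_C_mul_X_add_pow hμ hμ1 a hd hi, coeff_C_mul_X_add_pow hμ' hμ'1 a hd hi] at h1
    exact mul_left_cancel₀ (mul_ne_zero ha hdK) h1
  -- a homogeneous-degree-1 `x_f`-free polynomial is determined by these
  ext e
  by_cases he1 : e.degree = 1
  · -- `e = single i 1`
    obtain ⟨i, hi⟩ : ∃ i, e = Finsupp.single i 1 := by
      have hne : e ≠ 0 := fun h0 => by rw [h0, map_zero] at he1; exact zero_ne_one he1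
      obtain ⟨i, hi⟩ := Finsupp.ne_iff.mp hne
      refine ⟨i, ?_⟩
      have hle : Finsupp.single i 1 ≤ e := by
        rw [Finsupp.le_def]; intro k
        by_cases hk : k = i
        · rw [hk, Finsupp.single_eq_same]; exact Nat.one_le_iff_ne_zero.mpr hi
        · rw [Finsupp.single_apply, if_neg (Ne.symm hk)]; exact Nat.zero_le _
      exact (eq_of_le_of_degree_le hle (by rw [Finsupp.degree_single, he1])).symm
    subst hi
    by_cases hif : i = f
    · subst hif
      rw [notMem_support_iff.mp (fun hs => ?_), notMem_support_iff.mp (fun hs => ?_)]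
      · have := (hsuppμ' _ hs).1; rw [Finsupp.single_eq_same] at this; exact one_ne_zero this
      · have := (hsuppμ _ hs).1; rw [Finsupp.single_eq_same] at this; exact one_ne_zero this
    · exact hcoef i hif
  · rw [hμ1.coeff_eq_zero he1, hμ'1.coeff_eq_zero he1]

/-! ## 3. Two frames of the same residual agree to order `N` -/

/-- The part of `φ` beyond its linear part lies in `𝔪₀²` when `φ(0) = 0`. [folklore] -/
theorem sub_homogeneousComponent_one_mem_sq {φ : MvPolynomial (Fin 4) K} (h0 : constantCoeff φ = 0) :
    φ - homogeneousComponent 1 φ ∈ MvPolynomial.idealOfVars (Fin 4) K ^ 2 := by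
  rw [← natCast_le_ordZero_iff_mem_idealOfVars_pow, natCast_le_ordZero_iff_forall_homogeneousComponent_eq_zero]
  intro k hk
  rw [map_sub, homogeneousComponent_of_mem (homogeneousComponent_mem 1 φ)]
  interval_cases k
  · rw [if_neg (by norm_num), sub_zero, homogeneousComponent_zero, ← constantCoeff_eq, h0, map_zero]
  · rw [if_pos rfl, sub_self]

/-- **The degree-`d` part of a framed residual sees only the LINEAR part of the datum**: for `ord₀ G ≥ d`,
`φ(0) = 0`, `x_f ∉ vars φ`, `in_d (tsch f φ G) = tsch f (lin φ) (in_d G)`. [folklore] -/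
theorem homogeneousComponent_tsch_eq_tsch_linearPart {φ G : MvPolynomial (Fin 4) K} (h0 : constantCoeff φ = 0)
    (hφ : f ∉ φ.vars) {d : ℕ} (hG : (d : ℕ∞) ≤ ordZero G) :
    homogeneousComponent d (tsch f φ G) =
      tsch f (homogeneousComponent 1 φ) (homogeneousComponent d G) := by
  have hlin1 : (homogeneousComponent 1 φ).IsHomogeneous 1 := homogeneousComponent_isHomogeneous 1 φ
  have hlinv : f ∉ (homogeneousComponent 1 φ).vars := by
    rw [not_mem_vars_iff]
    intro e he
    by_contra hef
    have hcoef : coeff e (homogeneousComponent 1 φ) ≠ 0 := mem_support_iff.mp he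
    rw [coeff_homogeneousComponent] at hcoef
    split_ifs at hcoef with hdeg
    · exact hcoef (notMem_support_iff.mp fun hs => hef ((not_mem_vars_iff f φ).mp hφ e hs))
    · exact hcoef rfl
  -- `tsch f φ = tsch f (φ − lin φ) ∘ tsch f (lin φ)`
  have hcomp : tsch f φ = (tsch f (φ - homogeneousComponent 1 φ)).comp (tsch f (homogeneousComponent 1 φ)) := by
    rw [tsch_comp_tsch _ hlinv, add_sub_cancel]
  have hord : (d : ℕ∞) ≤ ordZero (tsch f (homogeneousComponent 1 φ) G) := by
    rw [ordZero_tsch hlinv (constantCoeff_eq_zero_of_isHomogeneous_one hlin1)]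
    exact hG
  rw [hcomp, AlgHom.comp_apply, homogeneousComponent_eq_of_sub_mem
    (tsch_sub_self_mem (sub_homogeneousComponent_one_mem_sq h0) hord), homogeneousComponent_tsch hlin1]

/-- **Two frames of the same residual have the same linear part**: if `φ(0) = ψ(0) = 0`, `x_f ∉ vars`,
`ord₀ G ≥ d`, `d` a unit, and both `tsch f φ G`, `tsch f ψ G` have degree-`d` part `a·x_f^d`, `b·x_f^d` with
`a ≠ 0`, then `lin φ = lin ψ`. [cite: CossartPiltant2009, I.8.3.6] [folklore] -/
theorem linearPart_eq_of_straight {φ ψ G : MvPolynomial (Fin 4) K} (h0φ : constantCoeff φ = 0)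
    (hφ : f ∉ φ.vars) (h0ψ : constantCoeff ψ = 0) (hψ : f ∉ ψ.vars) {d : ℕ} (hd : 1 ≤ d) (hdK : (d : K) ≠ 0)
    (hG : (d : ℕ∞) ≤ ordZero G) {a b : K} (ha : a ≠ 0)
    (hφd : homogeneousComponent d (tsch f φ G) = C a * X f ^ d)
    (hψd : homogeneousComponent d (tsch f ψ G) = C b * X f ^ d) :
    homogeneousComponent 1 φ = homogeneousComponent 1 ψ := by
  set lφ := homogeneousComponent 1 φ with hlφ
  set lψ := homogeneousComponent 1 ψ with hlψ
  have h1φ : lφ.IsHomogeneous 1 := homogeneousComponent_isHomogeneous 1 φ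
  have h1ψ : lψ.IsHomogeneous 1 := homogeneousComponent_isHomogeneous 1 ψ
  have hvφ : f ∉ lφ.vars := by
    rw [not_mem_vars_iff]; intro e he; by_contra hef
    have hcoef : coeff e lφ ≠ 0 := mem_support_iff.mp he
    rw [hlφ, coeff_homogeneousComponent] at hcoef
    split_ifs at hcoef
    · exact hcoef (notMem_support_iff.mp fun hs => hef ((not_mem_vars_iff f φ).mp hφ e hs))
    · exact hcoef rfl
  have hvψ : f ∉ lψ.vars := by
    rw [not_mem_vars_iff]; intro e he; by_contra hef
    have hcoef : coeff e lψ ≠ 0 := mem_support_iff.mp he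
    rw [hlψ, coeff_homogeneousComponent] at hcoef
    split_ifs at hcoef
    · exact hcoef (notMem_support_iff.mp fun hs => hef ((not_mem_vars_iff f ψ).mp hψ e hs))
    · exact hcoef rfl
  rw [homogeneousComponent_tsch_eq_tsch_linearPart h0φ hφ hG] at hφd
  rw [homogeneousComponent_tsch_eq_tsch_linearPart h0ψ hψ hG] at hψd
  -- undo the moves: `in_d G = a·(x_f − lφ)^d = b·(x_f − lψ)^d`
  have hGd : homogeneousComponent d G = C a * (X f + (-lφ)) ^ d := by
    have h := congrArg (tsch f (-lφ)) hφd
    rwa [tsch_neg_tsch hvφ, map_mul, algHom_C, MvPolynomial.algebraMap_eq, map_pow, tsch_X_self] at h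
  have hGd' : homogeneousComponent d G = C b * (X f + (-lψ)) ^ d := by
    have h := congrArg (tsch f (-lψ)) hψd
    rwa [tsch_neg_tsch hvψ, map_mul, algHom_C, MvPolynomial.algebraMap_eq, map_pow, tsch_X_self] at h
  have hneg := linearForm_eq_of_pow_eq (f := f) (by rwa [MvPolynomial.vars_neg]) h1φ.neg
    (by rwa [MvPolynomial.vars_neg]) h1ψ.neg ha hd hdK (by rw [← hGd]; exact hGd')
  exact neg_injective hneg

/-- **TWO FRAMES AGREE TO ORDER `N`**: `φ(0) = ψ(0) = 0`, `x_f ∉ vars`, `ord₀ G ≥ d`, `1 ≤ d` a unit of `K`,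
both framed residuals straight (`in_d = a·x_f^d`, `b·x_f^d`, `a ≠ 0`) and Tschirnhaus to order `N` (no
`x_f^{d-1}·u^m`, `|m| ≤ N`) — then `φ` and `ψ` agree in all degrees `≤ N`. [cite: Abhyankar1990, Lecture 22
p.174 and p.186] [folklore] -/
theorem jet_eq_of_frames {φ ψ G : MvPolynomial (Fin 4) K} (h0φ : constantCoeff φ = 0) (hφ : f ∉ φ.vars)
    (h0ψ : constantCoeff ψ = 0) (hψ : f ∉ ψ.vars) {d : ℕ} (hd : 1 ≤ d) (hdK : (d : K) ≠ 0)
    (hG : (d : ℕ∞) ≤ ordZero G) {a b : K} (ha : a ≠ 0)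
    (hφd : homogeneousComponent d (tsch f φ G) = C a * X f ^ d)
    (hψd : homogeneousComponent d (tsch f ψ G) = C b * X f ^ d) {N : ℕ}
    (hφN : ∀ n : Fin 4 →₀ ℕ, n f = d - 1 → n.degree ≤ N + (d - 1) → coeff n (tsch f φ G) = 0)
    (hψN : ∀ n : Fin 4 →₀ ℕ, n f = d - 1 → n.degree ≤ N + (d - 1) → coeff n (tsch f ψ G) = 0) :
    ∀ m : Fin 4 →₀ ℕ, m.degree ≤ N → coeff m φ = coeff m ψ := by
  have hlin := linearPart_eq_of_straight h0φ hφ h0ψ hψ hd hdK hG ha hφd hψd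
  set l := homogeneousComponent 1 φ with hl
  have h1 : l.IsHomogeneous 1 := homogeneousComponent_isHomogeneous 1 φ
  have hvl : f ∉ l.vars := by
    rw [not_mem_vars_iff]; intro e he; by_contra hef
    have hcoef : coeff e l ≠ 0 := mem_support_iff.mp he
    rw [hl, coeff_homogeneousComponent] at hcoef
    split_ifs at hcoef
    · exact hcoef (notMem_support_iff.mp fun hs => hef ((not_mem_vars_iff f φ).mp hφ e hs))
    · exact hcoef rfl
  have h0l : constantCoeff l = 0 := constantCoeff_eq_zero_of_isHomogeneous_one h1
  -- the straightened residual `G' := tsch f l G` and the two order-≥2 data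
  set G' := tsch f l G with hG'
  have hcompφ : tsch f φ = (tsch f (φ - l)).comp (tsch f l) := by rw [tsch_comp_tsch _ hvl, add_sub_cancel]
  have hcompψ : tsch f ψ = (tsch f (ψ - l)).comp (tsch f l) := by
    rw [tsch_comp_tsch _ hvl, add_sub_cancel]
  have hc : coeff (Finsupp.single f d) G' ≠ 0 := by
    have h := congrArg (coeff (Finsupp.single f d)) hφd
    rw [homogeneousComponent_tsch_eq_tsch_linearPart h0φ hφ hG, ← hl, ← homogeneousComponent_tsch h1,
      coeff_homogeneousComponent, if_pos (Finsupp.degree_single f d), X_pow_eq_monomial, C_mul_monomial,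
      mul_one, coeff_monomial, if_pos rfl] at h
    rw [hG', h]; exact ha
  have hsupp : ∀ χ : MvPolynomial (Fin 4) K, constantCoeff χ = 0 → f ∉ χ.vars →
      ∀ e ∈ (χ - l).support, e f = 0 ∧ 1 ≤ e.degree := fun χ h0χ hχ =>
    (forall_support_iff f (χ - l)).mpr ⟨by rw [map_sub, h0χ, h0l, sub_zero],
      (not_mem_vars_iff f (χ - l)).mpr fun e he => by
        have hne : coeff e (χ - l) ≠ 0 := mem_support_iff.mp he
        rw [coeff_sub] at hne
        by_cases hχe : coeff e χ = 0
        · have hle : coeff e l ≠ 0 := fun h => hne (by rw [hχe, h, sub_zero])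
          exact (not_mem_vars_iff f l).mp hvl e (mem_support_iff.mpr hle)
        · exact (not_mem_vars_iff f χ).mp hχ e (mem_support_iff.mpr hχe)⟩
  have key := jet_unique f hd hdK G' hc (hsupp φ h0φ hφ) (hsupp ψ h0ψ hψ) (tsch f (φ - l)) (tsch f (ψ - l))
    (tsch_X_self f _) (fun _ hi => tsch_X_of_ne _ hi) (tsch_X_self f _) (fun _ hi => tsch_X_of_ne _ hi)
    (N := N) (fun m hmf hm => by
      rw [hG', ← AlgHom.comp_apply, ← hcompφ]
      exact hφN _ (by rw [Finsupp.add_apply, hmf, Finsupp.single_eq_same, zero_add])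
        (by rw [map_add, Finsupp.degree_single]; omega))
    (fun m hmf hm => by
      rw [hG', ← AlgHom.comp_apply, ← hcompψ]
      exact hψN _ (by rw [Finsupp.add_apply, hmf, Finsupp.single_eq_same, zero_add])
        (by rw [map_add, Finsupp.degree_single]; omega))
  intro m hm
  have h := key m hm
  rw [coeff_sub, coeff_sub] at h
  linear_combination h

/-- **FRAME READINGS ARE CANONICAL**: under the hypotheses of `jet_eq_of_frames`, the two framed residuals have
the same coefficient at every monomial `x_f^j·u^m`, `|m| ≤ N`. [cite: Abhyankar1990, Lecture 22 p.186]
[folklore] -/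
theorem coeff_tsch_eq_of_frames {φ ψ G : MvPolynomial (Fin 4) K} (h0φ : constantCoeff φ = 0) (hφ : f ∉ φ.vars)
    (h0ψ : constantCoeff ψ = 0) (hψ : f ∉ ψ.vars) {d : ℕ} (hd : 1 ≤ d) (hdK : (d : K) ≠ 0)
    (hG : (d : ℕ∞) ≤ ordZero G) {a b : K} (ha : a ≠ 0)
    (hφd : homogeneousComponent d (tsch f φ G) = C a * X f ^ d)
    (hψd : homogeneousComponent d (tsch f ψ G) = C b * X f ^ d) {N : ℕ}
    (hφN : ∀ n : Fin 4 →₀ ℕ, n f = d - 1 → n.degree ≤ N + (d - 1) → coeff n (tsch f φ G) = 0)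
    (hψN : ∀ n : Fin 4 →₀ ℕ, n f = d - 1 → n.degree ≤ N + (d - 1) → coeff n (tsch f ψ G) = 0)
    (P : MvPolynomial (Fin 4) K) {m : Fin 4 →₀ ℕ} (hm : m.degree ≤ N) (j : ℕ) :
    coeff (m + Finsupp.single f j) (tsch f φ P) = coeff (m + Finsupp.single f j) (tsch f ψ P) :=
  coeff_tsch_eq_of_jet_eq hφ hψ (jet_eq_of_frames h0φ hφ h0ψ hψ hd hdK hG ha hφd hψd hφN hψN) P hm j

end FrameChange

end Summit.ResolutionOfSingularities.ResolutionOfSingularities.Theorems.PIDim4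

end
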